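import Summits.BirchSwinnertonDyer.BirchSwinnertonDyer.Theses.TameQuarticManinParity
import HarnessLib

/-!
# Route `TameQuarticManinParity`, LINE 19 (bsd-idea-3 g7), glue G19 `TprimeRedThreeDvdDegreeOfEdgeLaw`
# (stmt-BirchSwinnertonDyer-27754) — PROVED BY NAME (the planner's `Sketch19b-LINE19-tqmp.lean` argument)

Cell `pub/bsd-wall`, D-0145 line `route-BirchSwinnertonDyer-TeichmullerTwistDescent`, seat `bsd-line-ttd-p1` g9,
working the planner-of-record's TQMP LINE 19. BSD is NOT proved by this; Manin's conjecture is not proved by this;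
the instrument-born edge law E19 (`TprimeRedOptimalIsKodairaThree`, stmt-27752) and the Kodaira-III half K19
(`TprimeRedKodairaThreeManinUnitOfThreeDvdDegree`, stmt-27753) stay OPEN, hence so does the hard half
`TprimeRedManinUnitOfThreeDvdDegree` (stmt-24627). This file closes ONLY the glue.

## Statement (verbatim the route decl)

`TprimeRedOptimalIsKodairaThree → TprimeRedKodairaThreeManinUnitOfThreeDvdDegree → TprimeRedManinUnitOfThreeDvdDegree`.

## Proof

K19 has the binders of the hard half plus `v₃(Δ_min W) = 3`, which E19 supplies on the same binders. Pure logic.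
Design: theorems only; no definition, no named fact, no `sorry`; axioms `propext`, `Classical.choice`, `Quot.sound`.
-/

set_option autoImplicit false
-- D-0017: single-problem summit, so `Summit.BirchSwinnertonDyer.BirchSwinnertonDyer.…` repeats a namespace BY DESIGN.
set_option linter.dupNamespace false

namespace Summit.BirchSwinnertonDyer.BirchSwinnertonDyer.Theorems.TameQuarticManinParity

open Summit.BirchSwinnertonDyer.BirchSwinnertonDyer.Theses.TameQuarticManinParity

/-- **Glue G19** (stmt-BirchSwinnertonDyer-27754), by name: the 3-isogeny edge law E19 (the optimal curve of a
reducible (t′) class is the Kodaira-III end, `v₃(Δ_min) = 3`) and the Kodaira-III half K19 give the hard half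
`TprimeRedManinUnitOfThreeDvdDegree` (the planner's `Sketch19b.tprimeRedThreeDvdDegreeOfEdgeLaw_proof`). -/
theorem tprimeRedThreeDvdDegreeOfEdgeLaw_proof : TprimeRedThreeDvdDegreeOfEdgeLaw := by
  unfold TprimeRedThreeDvdDegreeOfEdgeLaw
  intro hE hK W _ _ _ hcm hadd ht hred D hopt hdeg h3
  exact hK W hcm hadd ht hred D hopt hdeg (hE W hcm hadd ht hred D hopt hdeg) h3

end Summit.BirchSwinnertonDyer.BirchSwinnertonDyer.Theorems.TameQuarticManinParity
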